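import Mathlib
import Summits.NavierStokesRegularity.NavierStokesRegularity.Theorems.PowerGaugeEulerLiouville.Negative.ForwardRelaxingClassicalFlow

/-!
# Crux `EulerZoomLiouville.PowerGaugeEulerLiouville` (stmt-NavierStokesRegularity-19832) — negative edge, GLOBAL-SOLUTION form:
# a relaxing classical Euler flow defined from slightly before time `0` refutes the crux (no local hypotheses)

Negative-lane record (prover hand leafhand-ns-eulerzoomliouville-8 g0; `--supports` stmt-19832).  The forward door
`powerGaugeEulerLiouville_false_of_forwardRelaxingClassicalFlow` carries pointwise bounds on the initial unit cylinder
`(0,1) × B₁` because Seregin's class allows blow-up at the final time.  For a flow that is classical on an open time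
interval containing `[0, ∞)` — e.g. the global smooth solution (if any) issuing from smooth data at time `−δ` — these
bounds are automatic (continuity on the compact `[0,1] × B̄₁`, `exists_bounds_on_unitCylinder_of_classical`), so:

* `powerGaugeEulerLiouville_false_of_relaxingGlobalSolution`: a classical Euler flow `(v,q)` on `(−δ, ∞) × ℝ³`,
  `δ > 0`, nonzero at one point of positive time, with bounded energy `∫|v(s)|² ≤ M` (`s > 0`), square-summable
  enstrophy `∫∫_{(0,∞)×ℝ³}|∇v|²_F ≤ M` and pressure budget `∫∫_{(0,∞)×ℝ³}|q|^{3/2} ≤ M`, refutes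
  `PowerGaugeEulerLiouville` (every `ρ ∈ (0,½]`).

So THE forward construction target reads: «a global smooth finite-energy solution of 3-D Euler whose enstrophy is
square-summable in time (with `∫₀^∞‖q‖_{3/2}^{3/2} < ∞`)».  None is known (see `…RelaxingFlowFatVorticity` for why
its vorticity must be fat).  WHAT THIS IS NOT: not a refutation of the crux, of a stub, or of the route; not a claim
about Navier–Stokes; nothing is constructed here. [folklore] -/

noncomputable section
set_option linter.dupNamespace false
namespace Summit.NavierStokesRegularity.NavierStokesRegularity.Theorems.PowerGaugeEulerLiouville.Negative

open MeasureTheory Set Function Filter Topology Metric Literature.Analysis Literature.Analysis.FluidPDE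
open scoped NNReal ENNReal

/-- **Local bounds on the initial unit cylinder are automatic for flows classical across time `0`.**  If `(v,q)` is a
classical Euler flow on `(−δ,∞) × ℝ³`, `δ > 0`, then `v`, `|∇v|²_F` and `q` are bounded by one constant on
`(0,1) × B₁` (continuity on the compact `[0,1] × B̄₁`). [folklore] -/
theorem exists_bounds_on_unitCylinder_of_classical {δ : ℝ} (hδ : 0 < δ)
    {v : ℝ → EuclideanSpace ℝ (Fin 3) → EuclideanSpace ℝ (Fin 3)} {q : ℝ → EuclideanSpace ℝ (Fin 3) → ℝ}
    (hsol : IsClassicalEulerSolutionOn (Ioi (-δ)) 0 v q) :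
    ∃ K : ℝ, (∀ s ∈ Ioo (0 : ℝ) 1, ∀ x ∈ ball (0 : EuclideanSpace ℝ (Fin 3)) 1, ‖v s x‖ ≤ K) ∧
      (∀ s ∈ Ioo (0 : ℝ) 1, ∀ x ∈ ball (0 : EuclideanSpace ℝ (Fin 3)) 1,
        frobeniusNormSq (fderiv ℝ (v s) x) ≤ K) ∧
      (∀ s ∈ Ioo (0 : ℝ) 1, ∀ x ∈ ball (0 : EuclideanSpace ℝ (Fin 3)) 1, ‖q s x‖ ≤ K) := by
  set Kc : Set (ℝ × EuclideanSpace ℝ (Fin 3)) := Icc (0 : ℝ) 1 ×ˢ closedBall (0 : EuclideanSpace ℝ (Fin 3)) 1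
    with hKc
  have hKcpt : IsCompact Kc := isCompact_Icc.prod (isCompact_closedBall 0 1)
  have hsub : Kc ⊆ Ioi (-δ) ×ˢ (univ : Set (EuclideanSpace ℝ (Fin 3))) :=
    fun z hz => ⟨lt_of_lt_of_le (by linarith) hz.1.1, mem_univ _⟩
  have hmem : ∀ s ∈ Ioo (0 : ℝ) 1, ∀ x ∈ ball (0 : EuclideanSpace ℝ (Fin 3)) 1,
      ((s, x) : ℝ × EuclideanSpace ℝ (Fin 3)) ∈ Kc :=
    fun s hs x hx => ⟨⟨hs.1.le, hs.2.le⟩, ball_subset_closedBall hx⟩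
  have hv : ContDiffOn ℝ (⊤ : ℕ∞) (uncurry v) (Ioi (-δ) ×ˢ (univ : Set (EuclideanSpace ℝ (Fin 3)))) :=
    hsol.smooth_velocity
  have hq : ContDiffOn ℝ (⊤ : ℕ∞) (uncurry q) (Ioi (-δ) ×ˢ (univ : Set (EuclideanSpace ℝ (Fin 3)))) :=
    hsol.smooth_pressure
  have hv1 : ContDiffOn ℝ 1 (uncurry v) (Ioi (-δ) ×ˢ (univ : Set (EuclideanSpace ℝ (Fin 3)))) :=
    hv.of_le (by norm_cast)
  -- velocity
  obtain ⟨K₁, hK₁⟩ := hKcpt.exists_bound_of_continuousOn (hv.continuousOn.mono hsub)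
  -- gradient
  have hG : ContinuousOn (fun z : ℝ × EuclideanSpace ℝ (Fin 3) => frobeniusNormSq (fderiv ℝ (v z.1) z.2))
      (Ioi (-δ) ×ˢ (univ : Set (EuclideanSpace ℝ (Fin 3)))) :=
    LerayHopfProofs.continuous_frobeniusNormSq.comp_continuousOn
      (continuousOn_fderiv_slice_of_contDiffOn hv1 isOpen_Ioi.uniqueDiffOn)
  obtain ⟨K₂, hK₂⟩ := hKcpt.exists_bound_of_continuousOn (hG.mono hsub)
  -- pressure
  obtain ⟨K₃, hK₃⟩ := hKcpt.exists_bound_of_continuousOn (hq.continuousOn.mono hsub)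
  refine ⟨max K₁ (max K₂ K₃), fun s hs x hx => ?_, fun s hs x hx => ?_, fun s hs x hx => ?_⟩
  · exact (hK₁ (s, x) (hmem s hs x hx)).trans (le_max_left _ _)
  · have h := hK₂ (s, x) (hmem s hs x hx)
    rw [Real.norm_eq_abs] at h
    exact ((le_abs_self _).trans h).trans ((le_max_left _ _).trans (le_max_right _ _))
  · exact (hK₃ (s, x) (hmem s hs x hx)).trans ((le_max_right _ _).trans (le_max_right _ _))

/-- **NEGATIVE EDGE, GLOBAL-SOLUTION FORM.**  A classical Euler flow `(v,q)` on `(−δ,∞) × ℝ³` (`δ > 0`), nonzero at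
some point of positive time, with bounded energy, square-summable enstrophy on `(0,∞)` and a finite space–time
`L^{3/2}` pressure budget on `(0,∞)`, refutes `PowerGaugeEulerLiouville` (stmt-19832). [folklore] -/
theorem powerGaugeEulerLiouville_false_of_relaxingGlobalSolution {δ : ℝ} (hδ : 0 < δ)
    {v : ℝ → EuclideanSpace ℝ (Fin 3) → EuclideanSpace ℝ (Fin 3)} {q : ℝ → EuclideanSpace ℝ (Fin 3) → ℝ}
    {M : ℝ≥0}
    (hsol : IsClassicalEulerSolutionOn (Ioi (-δ)) 0 v q)
    (hA : ∀ s : ℝ, 0 < s → ∫⁻ x, ‖v s x‖ₑ ^ 2 ≤ (M : ℝ≥0∞))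
    (hE : ∫⁻ z in Ioi (0 : ℝ) ×ˢ (univ : Set (EuclideanSpace ℝ (Fin 3))),
      ENNReal.ofReal (frobeniusNormSq (fderiv ℝ (v z.1) z.2)) ≤ (M : ℝ≥0∞))
    (hD : ∫⁻ z in Ioi (0 : ℝ) ×ˢ (univ : Set (EuclideanSpace ℝ (Fin 3))), ‖q z.1 z.2‖ₑ ^ (3 / 2 : ℝ) ≤ (M : ℝ≥0∞))
    {s₀ : ℝ} (hs₀ : 0 < s₀) {x₀ : EuclideanSpace ℝ (Fin 3)} (hne : v s₀ x₀ ≠ 0) :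
    ¬ Summit.NavierStokesRegularity.NavierStokesRegularity.Theses.EulerZoomLiouville.PowerGaugeEulerLiouville := by
  obtain ⟨K, hKu, hKH, hKp⟩ := exists_bounds_on_unitCylinder_of_classical hδ hsol
  have hsol' : IsClassicalEulerSolutionOn (Ioi (0 : ℝ)) 0 v q :=
    hsol.mono (Ioi_subset_Ioi (by linarith)) isOpen_Ioi.uniqueDiffOn
  exact powerGaugeEulerLiouville_false_of_forwardRelaxingClassicalFlow hsol' hA hE hD hKu hKH hKp hs₀ hne

end Summit.NavierStokesRegularity.NavierStokesRegularity.Theorems.PowerGaugeEulerLiouville.Negative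
end
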